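import Literature.NumberTheory.Transcendental.RivoalLinearForms
import HarnessLib

/-!
# Periods family, wave 0 — proofs: the Ball–Rivoal theorem (`ball_rivoal`)

Sibling proof file of `PeriodsWave0.lean`. It discharges the named fact
`Literature.NumberTheory.Transcendental.ball_rivoal` (**periods.S19**; Rivoal 2000, Théorème 1;
Ball–Rivoal 2001, Théorème 1): for every `ε > 0` and all large `a`,
`dim_ℚ (ℚ + ℚζ(3) + ⋯ + ℚζ(a')) ≥ (1 − ε) log a / (1 + log 2)` (`a'` the largest odd number
`≤ a`) — `ball_rivoal_holds`.

## Proof architecture (Rivoal 2000, §1–3)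

* Nesterenko's linear independence criterion — `NesterenkoCriterion.nesterenko_criterion`
  (`Literature/NumberTheory/DiophantineApproximation/`, proved via the Fischler–Zudilin–
  Chantanasiri Minkowski argument);
* Rivoal's very-well-poised series `S_n = ∑_k R_n(k)` (`RivoalSeriesDefs`), its expansion in
  `1, ζ(3), …, ζ(a)` with arithmetic and growth control (`OddZetaPartialFractions`,
  `OddZetaSeries` of the tree — the Ball–Rivoal/Fischler–Sprang–Zudilin partial fractions and
  symmetry — and `RivoalSeriesBounds` for the growth of the coefficients), and the existence of
  `lim S_n^{1/n}` with its size (`RivoalSeriesStirling`, `RivoalSeriesAsymptotics`);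
* the prime number theorem `d_n = e^{n+o(n)}` (the tree's `ChebyshevPsiDeLaValleePoussin_holds`)
  and the criterion give, for fixed admissible `(a, r)`, `dim ≥ (a−2r)log(r+1)/((a+1)(1+log 2)
  + (2r+1)(1+log(r+3)))` (`RivoalLinearForms.finrank_span_ge`);
* this file: the choice `r = ⌊a^{1−ε/4}⌋` (Rivoal takes `a/(log a)²`; any `r = a^{1−o(1)}` with
  `r log r = o(a)` works) and the elementary limit computation, then the passage from odd `a`
  to all `a`.

## References

* T. Rivoal, *La fonction zêta de Riemann prend une infinité de valeurs irrationnelles aux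
  entiers impairs*, C. R. Acad. Sci. Paris 331 (2000) 267–270, Théorème 1 and §3. [Rivoal2000]
* K. Ball, T. Rivoal, *Irrationalité d'une infinité de valeurs de la fonction zêta aux entiers
  impairs*, Invent. Math. 146 (2001) 193–207, Théorème 1. [BallRivoal2001]
-/

noncomputable section

open Finset Filter Real
open scoped Nat Topology

namespace Literature.NumberTheory.Transcendental

namespace RivoalSeries

/-! ### The choice `r = ⌊a^{1-δ}⌋` : deterministic inequalities -/

/-- **The optimisation step** (Rivoal 2000, end of §3, with `r = ⌊a^{1-δ}⌋`). Let `a ≥ 4`,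
`0 < δ < 1`, `u = a^{-δ} ≤ 1/4`, `L = log a` with `(1−δ)L > 4 + 4(1+log 2)`, and suppose the
"limit inequality" `(1−2u)(1−δ)(1+log 2) ≥ (1−ε)((1+1/a)(1+log 2) + (2u+1/a)(1+log 4+L))`.
Then `r = ⌊a^{1−δ}⌋` satisfies `1 ≤ r`, `2r+2 ≤ a`, the smallness condition of
`finrank_span_ge`, and `(1−ε) L/(1+log 2) ≤ (a−2r)log(r+1)/((a+1)(1+log 2)+(2r+1)(1+log(r+3)))`.
[cite: Rivoal2000, §3 (choice of r)] -/
theorem choice_of_r {a : ℕ} {δ ε : ℝ} (ha4 : 4 ≤ a) (hδ0 : 0 < δ) (hδ1 : δ < 1)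
    (hu : (a : ℝ) ^ (-δ) ≤ 1 / 4)
    (hL : 4 + 4 * (1 + Real.log 2) < (1 - δ) * Real.log a)
    (hmain : (1 - ε) * ((1 + 1 / (a : ℝ)) * (1 + Real.log 2) +
        (2 * (a : ℝ) ^ (-δ) + 1 / (a : ℝ)) * (1 + Real.log 4 + Real.log a)) ≤
      (1 - 2 * (a : ℝ) ^ (-δ)) * (1 - δ) * (1 + Real.log 2)) :
    let r := ⌊(a : ℝ) ^ (1 - δ)⌋₊
    1 ≤ r ∧ 2 * r + 2 ≤ a ∧
      (a : ℝ) + 1 + (2 * r + 1) * (1 + Real.log 2) < ((a : ℝ) - 2 * r) * Real.log (r + 1) ∧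
      (1 - ε) * Real.log a / (1 + Real.log 2) ≤
        ((a : ℝ) - 2 * r) * Real.log (r + 1) /
          (((a : ℝ) + 1) * (1 + Real.log 2) + (2 * r + 1) * (1 + Real.log (r + 3))) := by
  intro r
  set c₀ : ℝ := 1 + Real.log 2 with hc₀
  have hc₀0 : 0 < c₀ := by have := Real.log_pos one_lt_two; rw [hc₀]; linarith
  set u : ℝ := (a : ℝ) ^ (-δ) with hudef
  set x : ℝ := (a : ℝ) ^ (1 - δ) with hxdef
  set L : ℝ := Real.log a with hLdef
  have ha0 : (0 : ℝ) < a := by exact_mod_cast (show 0 < a by omega)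
  have ha0' : (a : ℝ) ≠ 0 := ha0.ne'
  have ha1 : (1 : ℝ) ≤ a := by exact_mod_cast (show 1 ≤ a by omega)
  have ha4' : (4 : ℝ) ≤ a := by exact_mod_cast ha4
  have hL0 : 0 < L := by rw [hLdef]; exact Real.log_pos (by linarith)
  have hu0 : 0 < u := Real.rpow_pos_of_pos ha0 _
  have hxu : x = a * u := by
    rw [hxdef, hudef, show (1 : ℝ) - δ = 1 + (-δ) by ring, Real.rpow_add ha0, Real.rpow_one]
  have hx1 : 1 ≤ x := Real.one_le_rpow ha1 (by linarith)
  have hx0 : 0 < x := by linarith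
  have hau : (a : ℝ) * u ≤ a / 4 := by
    have := mul_le_mul_of_nonneg_left hu ha0.le; linarith
  have hxa : x ≤ a / 4 := by rw [hxu]; exact hau
  have hlogx : Real.log x = (1 - δ) * L := by rw [hxdef, Real.log_rpow ha0]
  have h1δ : 0 < 1 - δ := by linarith
  have hδL : 0 ≤ (1 - δ) * L := mul_nonneg h1δ.le hL0.le
  -- `r`
  have hr1 : 1 ≤ r := Nat.le_floor (by exact_mod_cast hx1)
  have hrx : (r : ℝ) ≤ x := Nat.floor_le hx0.le
  have hxr : x < r + 1 := Nat.lt_floor_add_one x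
  have hr0 : (0 : ℝ) ≤ r := Nat.cast_nonneg r
  have hC1 : 2 * r + 2 ≤ a := by
    have : (2 * r + 2 : ℝ) ≤ a := by linarith
    exact_mod_cast this
  -- `log(r+1) ≥ (1-δ) L ≥ 0`
  have hlogr : (1 - δ) * L ≤ Real.log (r + 1) := by
    rw [← hlogx]; exact Real.log_le_log hx0 hxr.le
  have hlogr0 : 0 ≤ Real.log ((r : ℝ) + 1) := Real.log_nonneg (by linarith)
  have ha2r : (a : ℝ) / 2 ≤ (a : ℝ) - 2 * r := by linarith
  -- (C2)
  have hNum : (a : ℝ) / 2 * ((1 - δ) * L) ≤ ((a : ℝ) - 2 * r) * Real.log (r + 1) :=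
    mul_le_mul ha2r hlogr hδL (by linarith)
  have hC2 : (a : ℝ) + 1 + (2 * r + 1) * c₀ < ((a : ℝ) - 2 * r) * Real.log (r + 1) := by
    have h1 : (2 * (r : ℝ) + 1) * c₀ ≤ ((a : ℝ) / 2 + 1) * c₀ :=
      mul_le_mul_of_nonneg_right (by linarith) hc₀0.le
    have h2 : c₀ ≤ a * c₀ := le_mul_of_one_le_left hc₀0.le ha1
    have h3 := mul_lt_mul_of_pos_left hL ha0
    have h4 : 0 ≤ (a : ℝ) * c₀ := by positivity
    nlinarith [h1, h2, h3, h4]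
  refine ⟨hr1, hC1, hC2, ?_⟩
  -- (C3)
  set M : ℝ := 1 + Real.log 4 + L with hM
  have hM0 : 0 < M := by
    have : 0 ≤ Real.log (4 : ℝ) := Real.log_nonneg (by norm_num)
    rw [hM]; linarith
  set NumL : ℝ := (a : ℝ) * (1 - 2 * u) * (1 - δ) * L with hNumL
  set DenU : ℝ := ((a : ℝ) + 1) * c₀ + (2 * (a : ℝ) * u + 1) * M with hDenU
  set Num : ℝ := ((a : ℝ) - 2 * r) * Real.log (r + 1) with hNumdef
  set Den : ℝ := ((a : ℝ) + 1) * c₀ + (2 * r + 1) * (1 + Real.log (r + 3)) with hDendef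
  have h12u : 0 ≤ 1 - 2 * u := by linarith
  have hNumL0 : 0 ≤ NumL := by rw [hNumL]; positivity
  have hNumL_le : NumL ≤ Num := by
    rw [hNumL, hNumdef]
    have h1 : (a : ℝ) * (1 - 2 * u) ≤ (a : ℝ) - 2 * r := by rw [hxu] at hrx; linarith
    have h2 : 0 ≤ (a : ℝ) * (1 - 2 * u) := by positivity
    calc (a : ℝ) * (1 - 2 * u) * (1 - δ) * L = ((a : ℝ) * (1 - 2 * u)) * ((1 - δ) * L) := by ring
      _ ≤ ((a : ℝ) - 2 * r) * Real.log (r + 1) := mul_le_mul h1 hlogr hδL (by linarith)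
  have hlog4 : Real.log ((r : ℝ) + 3) ≤ Real.log 4 + L := by
    rw [hLdef, ← Real.log_mul (by norm_num) ha0']
    exact Real.log_le_log (by linarith) (by linarith)
  have hlogr3 : 0 ≤ Real.log ((r : ℝ) + 3) := Real.log_nonneg (by linarith)
  have hDen0 : 0 < Den := by rw [hDendef]; positivity
  have hDen_le : Den ≤ DenU := by
    rw [hDendef, hDenU]
    have h1 : (2 * (r : ℝ) + 1) ≤ 2 * a * u + 1 := by rw [hxu] at hrx; linarith
    have h2 : 1 + Real.log ((r : ℝ) + 3) ≤ M := by rw [hM]; linarith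
    have := mul_le_mul h1 h2 (by linarith) (by positivity)
    linarith
  have hDenU0 : 0 < DenU := lt_of_lt_of_le hDen0 hDen_le
  -- from `hmain`: `(1-ε) L DenU ≤ NumL c₀`
  have hkey : (1 - ε) * L * DenU ≤ NumL * c₀ := by
    have h := mul_le_mul_of_nonneg_left hmain (mul_nonneg ha0.le hL0.le)
    have e1 : (a : ℝ) * L * ((1 - ε) * ((1 + 1 / (a : ℝ)) * c₀ + (2 * u + 1 / (a : ℝ)) * M)) =
        (1 - ε) * L * DenU := by
      rw [hDenU]; field_simp
    have e2 : (a : ℝ) * L * ((1 - 2 * u) * (1 - δ) * c₀) = NumL * c₀ := by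
      rw [hNumL]; ring
    rw [e1, e2] at h
    exact h
  calc (1 - ε) * Real.log a / (1 + Real.log 2) = (1 - ε) * L / c₀ := by rw [hLdef, hc₀]
    _ ≤ NumL / DenU := by
        rw [div_le_div_iff₀ hc₀0 hDenU0]; linarith
    _ ≤ Num / DenU := div_le_div_of_nonneg_right hNumL_le hDenU0.le
    _ ≤ Num / Den := div_le_div_of_nonneg_left (hNumL0.trans hNumL_le) hDen0 hDen_le

/-! ### The limit inequalities hold for large `a` -/

/-- `a^{-δ} → 0`, `a^{-δ} log a → 0`, `log a / a → 0`, `1/a → 0` along the naturals, packaged as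
the convergence of the two sides of the limit inequality of `choice_of_r`: for `0 < δ`, the
function `(1−ε)((1+1/a)c₀ + (2a^{-δ}+1/a)(1+log 4+log a)) − (1−2a^{-δ})(1−δ)c₀` tends to
`(1−ε)c₀ − (1−δ)c₀`. [folklore] -/
theorem tendsto_limit_ineq (δ ε : ℝ) (hδ0 : 0 < δ) :
    Tendsto (fun a : ℕ => (1 - ε) * ((1 + 1 / (a : ℝ)) * (1 + Real.log 2) +
        (2 * (a : ℝ) ^ (-δ) + 1 / (a : ℝ)) * (1 + Real.log 4 + Real.log a)) -
      (1 - 2 * (a : ℝ) ^ (-δ)) * (1 - δ) * (1 + Real.log 2)) atTop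
      (𝓝 ((1 - ε) * (1 + Real.log 2) - (1 - δ) * (1 + Real.log 2))) := by
  -- the four basic sequences
  have hu : Tendsto (fun a : ℕ => (a : ℝ) ^ (-δ)) atTop (𝓝 0) :=
    (tendsto_rpow_neg_atTop hδ0).comp tendsto_natCast_atTop_atTop
  have hv : Tendsto (fun a : ℕ => 1 / (a : ℝ)) atTop (𝓝 0) := tendsto_one_div_atTop_nhds_zero_nat
  have hw : Tendsto (fun a : ℕ => (a : ℝ) ^ (-δ) * Real.log a) atTop (𝓝 0) := by
    have h := (isLittleO_log_rpow_atTop hδ0).tendsto_div_nhds_zero.comp tendsto_natCast_atTop_atTop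
    refine h.congr' ?_
    filter_upwards [eventually_ge_atTop 1] with a ha
    have ha0 : (0 : ℝ) < a := by exact_mod_cast ha
    simp only [Function.comp_apply]
    rw [Real.rpow_neg ha0.le, div_eq_inv_mul]
  have hz : Tendsto (fun a : ℕ => Real.log a * (1 / (a : ℝ))) atTop (𝓝 0) := by
    have h := Real.isLittleO_log_id_atTop.tendsto_div_nhds_zero.comp tendsto_natCast_atTop_atTop
    refine h.congr' (Eventually.of_forall fun a => ?_)
    simp only [Function.comp_apply, id_eq]; ring
  -- combine
  have h := ((((hv.const_add 1).mul_const (1 + Real.log 2)).add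
    ((((hu.const_mul 2).add hv).mul_const (1 + Real.log 4)).add
      (((hw.const_mul 2).add hz)))).const_mul (1 - ε)).sub
    (((hu.const_mul 2).const_sub 1).mul_const ((1 - δ) * (1 + Real.log 2)))
  simp only [mul_zero, add_zero, sub_zero, zero_mul] at h
  refine (h.congr fun a => ?_).trans ?_
  · ring
  · ring_nf; exact le_rfl

/-- For `0 < ε < 1` and `δ = ε/4`, all hypotheses of `choice_of_r` hold for large `a`.
[folklore] -/
theorem eventually_hyps {ε : ℝ} (hε0 : 0 < ε) (hε1 : ε < 1) :
    ∀ᶠ a : ℕ in atTop, 4 ≤ a ∧ (a : ℝ) ^ (-(ε / 4)) ≤ 1 / 4 ∧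
      4 + 4 * (1 + Real.log 2) < (1 - ε / 4) * Real.log a ∧
      (1 - ε) * ((1 + 1 / (a : ℝ)) * (1 + Real.log 2) +
          (2 * (a : ℝ) ^ (-(ε / 4)) + 1 / (a : ℝ)) * (1 + Real.log 4 + Real.log a)) ≤
        (1 - 2 * (a : ℝ) ^ (-(ε / 4))) * (1 - ε / 4) * (1 + Real.log 2) := by
  have hδ0 : 0 < ε / 4 := by positivity
  have hc₀ : 0 < 1 + Real.log 2 := by have := Real.log_pos one_lt_two; linarith
  have hu : Tendsto (fun a : ℕ => (a : ℝ) ^ (-(ε / 4))) atTop (𝓝 0) :=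
    (tendsto_rpow_neg_atTop hδ0).comp tendsto_natCast_atTop_atTop
  have hL : Tendsto (fun a : ℕ => (1 - ε / 4) * Real.log a) atTop atTop :=
    Tendsto.const_mul_atTop (by linarith) (Real.tendsto_log_atTop.comp tendsto_natCast_atTop_atTop)
  have hlim := tendsto_limit_ineq (ε / 4) ε hδ0
  have hneg : (1 - ε) * (1 + Real.log 2) - (1 - ε / 4) * (1 + Real.log 2) < 0 := by nlinarith
  filter_upwards [eventually_ge_atTop 4, hu.eventually_le_const (by norm_num : (0 : ℝ) < 1 / 4),
    hL.eventually_gt_atTop _, hlim.eventually_lt_const hneg] with a h1 h2 h3 h4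
  exact ⟨h1, h2, h3, by linarith⟩

/-! ### Conclusion for odd `a`, and the set of odd zeta values -/

/-- For `0 < ε < 1`: for all large ODD `a`, `(1−ε) log a/(1+log 2) ≤ dim_ℚ span{1,ζ(3),…,ζ(a)}`
(the family indexed by `Fin ((a-1)/2 + 1)`). [cite: Rivoal2000, Théorème 1 (odd a)] -/
theorem eventually_finrank_ge {ε : ℝ} (hε0 : 0 < ε) (hε1 : ε < 1) :
    ∀ᶠ a : ℕ in atTop, Odd a →
      (1 - ε) * Real.log a / (1 + Real.log 2) ≤
        Module.finrank ℚ (Submodule.span ℚ (Set.range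
          (Fin.cons (1 : ℝ) (fun j : Fin ((a - 1) / 2) => zetaValue (2 * (j : ℕ) + 3)) :
            Fin ((a - 1) / 2 + 1) → ℝ))) := by
  filter_upwards [eventually_hyps hε0 hε1] with a ha hodd
  obtain ⟨ha4, hu, hL, hmain⟩ := ha
  obtain ⟨hr1, hC1, hC2, hLB⟩ := choice_of_r (ε := ε) ha4 (by positivity) (by linarith) hu hL hmain
  exact hLB.trans (finrank_span_ge a _ hodd hr1 hC1 hC2)

/-- For odd `a`, the range of the family `(1, ζ(3), ζ(5), …, ζ(a))` is the set
`{1} ∪ {ζ(k) : k odd, 3 ≤ k ≤ a}` of `ball_rivoal`. [folklore] -/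
theorem range_cons_eq {a : ℕ} (hodd : Odd a) :
    Set.range (Fin.cons (1 : ℝ) (fun j : Fin ((a - 1) / 2) => zetaValue (2 * (j : ℕ) + 3)) :
        Fin ((a - 1) / 2 + 1) → ℝ) =
      insert (1 : ℝ) {x | ∃ k : ℕ, Odd k ∧ 3 ≤ k ∧ k ≤ a ∧ x = zetaValue k} := by
  obtain ⟨N, hN⟩ := hodd
  have hN' : (a - 1) / 2 = N := by omega
  ext x
  simp only [Set.mem_range, Set.mem_insert_iff, Set.mem_setOf_eq]
  constructor
  · rintro ⟨i, rfl⟩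
    refine Fin.cases (Or.inl (by simp)) (fun j => Or.inr ?_) i
    refine ⟨2 * (j : ℕ) + 3, ⟨(j : ℕ) + 1, by ring⟩, by omega, ?_, by simp⟩
    have := j.isLt; omega
  · rintro (rfl | ⟨k, ⟨l, rfl⟩, h3, hka, rfl⟩)
    · exact ⟨0, by simp⟩
    · refine ⟨Fin.succ ⟨l - 1, by omega⟩, ?_⟩
      simp only [Fin.cons_succ]
      congr 1; omega

/-- The set of odd zeta values up to an even `a` is that up to `a − 1`. [folklore] -/
theorem oddZetaSet_even {a : ℕ} (ha : Even a) (ha1 : 1 ≤ a) :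
    {x : ℝ | ∃ k : ℕ, Odd k ∧ 3 ≤ k ∧ k ≤ a ∧ x = zetaValue k} =
      {x : ℝ | ∃ k : ℕ, Odd k ∧ 3 ≤ k ∧ k ≤ a - 1 ∧ x = zetaValue k} := by
  ext x
  simp only [Set.mem_setOf_eq]
  constructor
  · rintro ⟨k, hk, h3, hka, rfl⟩
    refine ⟨k, hk, h3, ?_, rfl⟩
    obtain ⟨l, rfl⟩ := hk; obtain ⟨m, rfl⟩ := ha; omega
  · rintro ⟨k, hk, h3, hka, rfl⟩
    exact ⟨k, hk, h3, by omega, rfl⟩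

end RivoalSeries

/-- **periods.S19 — the Ball–Rivoal theorem** (Rivoal 2000, Théorème 1; Ball–Rivoal 2001,
Théorème 1): PROVED. For every `ε > 0` and all sufficiently large `a`, the `ℚ`-span of
`1, ζ(3), ζ(5), …, ζ(a')` (`a'` the largest odd number `≤ a`) has dimension at least
`(1 − ε) log a / (1 + log 2)`. Discharges `ball_rivoal`. [cite: Rivoal2000, Théorème 1] -/
theorem ball_rivoal_holds : ball_rivoal := by
  intro ε hε
  -- reduce to `0 < ε < 1`
  wlog hε1 : ε < 1 generalizing ε with H
  · have h := H (1 / 2) (by norm_num) (by norm_num)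
    filter_upwards [h, eventually_ge_atTop 1] with a ha ha1
    refine le_trans ?_ ha
    have hlog : 0 ≤ Real.log a := Real.log_nonneg (by exact_mod_cast ha1)
    have hc : 0 < 1 + Real.log 2 := by have := Real.log_pos one_lt_two; linarith
    apply div_le_div_of_nonneg_right _ hc.le
    nlinarith
  -- odd `a` with `ε/2`, then all `a`
  have hε2 : 0 < ε / 2 := by positivity
  have hodd := RivoalSeries.eventually_finrank_ge hε2 (by linarith)
  obtain ⟨A, hA⟩ := eventually_atTop.1 hodd
  -- `log a ≤ log (a-1) + 1` and the absorption of the constant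
  have hlog : Tendsto (fun a : ℕ => Real.log a) atTop atTop :=
    Real.tendsto_log_atTop.comp tendsto_natCast_atTop_atTop
  filter_upwards [eventually_ge_atTop (A + 2), hlog.eventually_ge_atTop (2 / ε)] with a haA haL
  have hc : 0 < 1 + Real.log 2 := by have := Real.log_pos one_lt_two; linarith
  rcases Nat.even_or_odd a with heven | hodda
  · -- even `a`: use `a - 1`
    have h := hA (a - 1) (by omega) (by obtain ⟨m, rfl⟩ := heven; exact ⟨m - 1, by omega⟩)
    rw [RivoalSeries.range_cons_eq (by obtain ⟨m, rfl⟩ := heven; exact ⟨m - 1, by omega⟩)] at h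
    rw [RivoalSeries.oddZetaSet_even heven (by omega)]
    refine le_trans ?_ h
    apply div_le_div_of_nonneg_right _ hc.le
    have ha1 : (1 : ℝ) ≤ ((a - 1 : ℕ) : ℝ) := by exact_mod_cast (show 1 ≤ a - 1 by omega)
    have ha0 : (0 : ℝ) < a := by exact_mod_cast (show 0 < a by omega)
    have hlog1 : Real.log a ≤ Real.log ((a - 1 : ℕ) : ℝ) + 1 := by
      have e : (a : ℝ) = ((a - 1 : ℕ) : ℝ) + 1 := by
        rw [Nat.cast_sub (by omega)]; push_cast; ring
      rw [e]
      have h1 := Real.log_le_sub_one_of_pos (show 0 < (((a - 1 : ℕ) : ℝ) + 1) / ((a - 1 : ℕ) : ℝ) by positivity)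
      rw [Real.log_div (by positivity) (by positivity)] at h1
      have h2 : (((a - 1 : ℕ) : ℝ) + 1) / ((a - 1 : ℕ) : ℝ) - 1 = 1 / ((a - 1 : ℕ) : ℝ) := by
        field_simp; ring
      rw [h2] at h1
      have h3 : 1 / ((a - 1 : ℕ) : ℝ) ≤ 1 := by rw [div_le_one (by positivity)]; exact ha1
      linarith
    have hlog0 : 0 ≤ Real.log ((a - 1 : ℕ) : ℝ) := Real.log_nonneg ha1
    have : 2 / ε ≤ Real.log a := haL
    rw [div_le_iff₀ hε] at this
    nlinarith
  · have h := hA a (by omega) hodda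
    rw [RivoalSeries.range_cons_eq hodda] at h
    refine le_trans ?_ h
    apply div_le_div_of_nonneg_right _ hc.le
    have hlog0 : 0 ≤ Real.log a := Real.log_nonneg (by exact_mod_cast (show 1 ≤ a by omega))
    nlinarith

end Literature.NumberTheory.Transcendental
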